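import Mathlib
import Literature.Analysis.SpecialFunctions.GaussLegendreQuadrature
import Literature.Analysis.Quadrature.GaussLegendreAnalytic
import Literature.Analysis.Quadrature.ChebyshevCoefficients
import Literature.Analysis.Quadrature.GaussLegendreAliasing

/-!
# Gauss–Legendre quadrature of analytic integrands: Trefethen's constant `64/15` (Thm. 4.5 (4.14))

**Theorem** [cite: Trefethen2008, Thm. 4.5 (4.14)] (p. 75 loc. cit., for the rule with `n + 1`
nodes): *if `f` is analytic with `|f(z)| ≤ M` in the region bounded by the ellipse with foci `±1`
and major and minor semiaxis lengths summing to `ρ > 1`, then for each `n ≥ 0`,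
`|I - I_n| ≤ 64 M / (15 (1 - ρ^{-2}) ρ^{2n+2})`* `≤ 64 M / (15 (ρ - 1) ρ^{2n+1})`.

`GaussLegendreAnalytic` (`norm_integral_sub_gaussLegendre_le`, `…_le_interval`) formalises this
for the `n`-POINT rule, `n ≥ 1`, as `8 M / ((ρ - 1) ρ^{2n-1})` — the paper's rate with the constant
`8 = 4 · 2` from the crude bound `|∫ T_j - Σ_x w_x T_j(x)| ≤ 4` on every aliased Chebyshev
polynomial.  This file supplies the paper's constant for `n ≥ 2` nodes:
`‖∫_{-1}^{1} f - Σ_x w_x f(x)‖ ≤ 64 M / (15 (ρ - 1) ρ^{2n-1})`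
(`norm_integral_sub_gaussLegendre_le_of_two_le`; on `[a, b]`:
`norm_integral_sub_gaussLegendre_le_interval_of_two_le`), by combining
* the Chebyshev-coefficient bound for analytic functions, `|a_j(f)| ≤ 2 M ρ^{-j}`
  (`norm_chebCoeff_le_of_differentiableOn_bernsteinEllipse`; (4.7) loc. cit., Bernstein 1912),
  proved as loc. cit. / `GaussLegendreAnalytic` by shifting the contour of the Fourier integral
  of the `2π`-periodic analytic function `f(cos θ)` (the contour-shift lemma is transcribed from
  `GaussLegendreAnalytic`, where it is private), and
* the aliasing lemma `norm_integral_sub_gaussLegendre_le_of_chebCoeff_le` (`GaussLegendreAliasing`: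
  `(32/15) Σ_{j ≥ 2n} b_j` for `n ≥ 2`), with `Σ_{j ≥ 2n} 2 M ρ^{-j} = 2 M / ((ρ - 1) ρ^{2n-1})`.
The hypothesis is, as in `GaussLegendreAnalytic`, "analytic and bounded by `M` on the OPEN ellipse
region `E_ρ = bernsteinEllipse ρ`" (weaker than the paper's closed region).  For `n = 1` only the
constant-`8` theorem is available here (the aliasing lemma is stated for `n ≥ 2`).

## References

* L. N. Trefethen, *Is Gauss quadrature better than Clenshaw–Curtis?*, SIAM Review **50** (2008)
  67–87, Thm. 4.5 (4.14), (4.7), §5. [cite: Trefethen2008, Thm. 4.5 (4.14)]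

AI-produced formalisation (H21 engines group, seat eng-quad-3, 2026-08-20); no facts, no axioms
beyond Mathlib's, no `sorry`.
-/

open Complex Set MeasureTheory Filter Topology

open scoped Real Interval

namespace Literature.Analysis.Quadrature

open Literature.Analysis.SpecialFunctions

/-! ### Fourier coefficients of periodic functions analytic in a strip -/

/-- `Re(-(2π i n (x + iσ)/T)) = 2π n σ / T`. [folklore] -/
private theorem re_exponent (n : ℤ) (x σ T : ℝ) :
    (-(2 * π * I * n * (x + σ * I) / T)).re = 2 * π * n * σ / T := by
  simp [Complex.div_ofReal_re]
  ring

/-- Contour shift (transcribed from `GaussLegendreAnalytic`, where it is private): if `f` is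
`T`-periodic, analytic in `|Im z| < a` and bounded by `M` there, then for `0 ≤ a' < a` and every
`n ∈ ℤ`, `‖∫_0^T e^{-2πi n x/T} f(x) dx‖ ≤ T M e^{-2π a' |n| / T}`. [folklore] -/
private theorem norm_integral_exp_mul_le {f : ℂ → ℂ} {T a M : ℝ} (hT : 0 < T)
    (hd : DifferentiableOn ℂ f {z : ℂ | |z.im| < a}) (hper : ∀ z : ℂ, f (z + T) = f z)
    (hM : ∀ z : ℂ, |z.im| < a → ‖f z‖ ≤ M) (n : ℤ) {a' : ℝ} (ha'0 : 0 ≤ a') (ha' : a' < a) :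
    ‖∫ x in (0 : ℝ)..T, cexp (-(2 * π * I * n * x / T)) * f x‖ ≤
      T * M * Real.exp (-(2 * π * a' * |(n : ℝ)| / T)) := by
  set g : ℂ → ℂ := fun z => cexp (-(2 * π * I * n * z / T)) * f z with hg
  have hTc : (T : ℂ) ≠ 0 := by exact_mod_cast hT.ne'
  -- `g` is `T`-periodic
  have hg_per : ∀ z, g (z + T) = g z := by
    intro z
    simp only [hg]
    rw [hper]
    congr 1
    have hsplit : (2 * π * I * n * (z + T) / T : ℂ) = 2 * π * I * n * z / T + 2 * π * I * n := by
      rw [mul_add, add_div, mul_div_assoc (2 * π * I * n) (T : ℂ) T, div_self hTc, mul_one]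
    rw [hsplit, show -(2 * π * I * n * z / T + 2 * π * I * n) =
      -(2 * π * I * n * z / T) + ((-n : ℤ) : ℂ) * (2 * π * I) by push_cast; ring]
    rw [Complex.exp_add, Complex.exp_eq_one_iff.mpr ⟨-n, rfl⟩, mul_one]
  -- `g` is analytic in the strip
  have hg_diff : DifferentiableOn ℂ g {z : ℂ | |z.im| < a} := by
    refine DifferentiableOn.mul (Differentiable.differentiableOn ?_) hd
    exact Complex.differentiable_exp.comp
      (((differentiable_const _).mul differentiable_id).div_const _).neg
  -- shifting the segment `[0, T]` vertically by `σ`, `|σ| < a`, does not change `∫ g`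
  have hshift : ∀ σ : ℝ, |σ| < a →
      ∫ x in (0 : ℝ)..T, g x = ∫ x in (0 : ℝ)..T, g (x + σ * I) := by
    intro σ hσ
    have hre : ((T : ℂ) + σ * I).re = T := by simp
    have him : ((T : ℂ) + σ * I).im = σ := by simp
    have H : DifferentiableOn ℂ g
        ([[(0 : ℂ).re, ((T : ℂ) + σ * I).re]] ×ℂ [[(0 : ℂ).im, ((T : ℂ) + σ * I).im]]) := by
      refine hg_diff.mono fun z hz => ?_
      rw [hre, him, Complex.zero_re, Complex.zero_im, mem_reProdIm] at hz
      have h2 := hz.2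
      rw [mem_uIcc] at h2
      show |z.im| < a
      rcases h2 with ⟨h1, h2⟩ | ⟨h1, h2⟩
      · rw [abs_of_nonneg h1]
        exact h2.trans_lt ((le_abs_self σ).trans_lt hσ)
      · rw [abs_of_nonpos h2]
        exact (neg_le_neg h1).trans_lt ((neg_le_abs σ).trans_lt hσ)
    have key := Complex.integral_boundary_rect_eq_zero_of_differentiableOn g 0 ((T : ℂ) + σ * I) H
    simp only [hre, him, Complex.zero_re, Complex.zero_im, ofReal_zero, zero_mul, add_zero,
      zero_add, smul_eq_mul] at key
    have hv : (∫ y in (0 : ℝ)..σ, g ((T : ℂ) + y * I)) = ∫ y in (0 : ℝ)..σ, g (y * I) :=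
      intervalIntegral.integral_congr fun y _ => by rw [add_comm, hg_per]
    rw [hv] at key
    linear_combination key
  -- pointwise bound on the shifted segment
  have hbound : ∀ σ : ℝ, |σ| < a → ∀ x : ℝ,
      ‖g (x + σ * I)‖ ≤ Real.exp (2 * π * n * σ / T) * M := by
    intro σ hσ x
    simp only [hg]
    rw [norm_mul, Complex.norm_exp, re_exponent]
    refine mul_le_mul_of_nonneg_left (hM _ ?_) (Real.exp_pos _).le
    simpa using hσ
  -- choose the sign of the shift according to the sign of `n`
  have main : ∀ σ : ℝ, |σ| < a → 2 * π * n * σ / T = -(2 * π * a' * |(n : ℝ)| / T) →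
      ‖∫ x in (0 : ℝ)..T, g x‖ ≤ T * M * Real.exp (-(2 * π * a' * |(n : ℝ)| / T)) := by
    intro σ hσ hexp
    rw [hshift σ hσ]
    have h := intervalIntegral.norm_integral_le_of_norm_le_const (a := (0 : ℝ)) (b := T)
      (f := fun x : ℝ => g (x + σ * I)) (C := Real.exp (2 * π * n * σ / T) * M)
      (fun x _ => hbound σ hσ x)
    rw [sub_zero, abs_of_pos hT, hexp] at h
    linarith [h]
  rcases le_or_gt 0 n with hn | hn
  · have habs : |(n : ℝ)| = n := abs_of_nonneg (by exact_mod_cast hn)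
    refine main (-a') (by rw [abs_neg, abs_of_nonneg ha'0]; exact ha') ?_
    rw [habs]
    ring
  · have habs : |(n : ℝ)| = -n := abs_of_neg (by exact_mod_cast hn)
    refine main a' (by rw [abs_of_nonneg ha'0]; exact ha') ?_
    rw [habs]
    ring

/-! ### Chebyshev coefficients of functions analytic in a Bernstein ellipse -/

/-- The Chebyshev coefficient as a full-period Fourier integral:
`π a_j(f) = ∫_0^{2π} f(cos θ) e^{-ijθ} dθ` (fold `[π, 2π]` onto `[0, π]` by `θ ↦ 2π - θ`).
[folklore] -/
private theorem pi_mul_chebCoeff_eq (f : ℝ → ℂ) (hf : ContinuousOn f (Icc (-1 : ℝ) 1)) (j : ℕ) :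
    (π : ℂ) * chebCoeff f j =
      ∫ θ in (0 : ℝ)..2 * π, cexp (-(2 * π * I * (j : ℤ) * θ / ((2 * π : ℝ) : ℂ))) *
        f (Real.cos θ) := by
  have hπ : (π : ℂ) ≠ 0 := by exact_mod_cast Real.pi_pos.ne'
  have h2π : ((2 * π : ℝ) : ℂ) ≠ 0 := by exact_mod_cast Real.two_pi_pos.ne'
  have hexp : ∀ θ : ℝ, cexp (-(2 * π * I * (j : ℤ) * θ / ((2 * π : ℝ) : ℂ))) =
      cexp (-(I * j * θ)) := by
    intro θ
    congr 2
    push_cast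
    field_simp
  simp_rw [hexp]
  -- continuity of the integrand pieces
  have hfc : Continuous fun θ : ℝ => f (Real.cos θ) :=
    hf.comp_continuous Real.continuous_cos Real.cos_mem_Icc
  have hi : ∀ a b : ℝ, IntervalIntegrable (fun θ : ℝ => cexp (-(I * j * θ)) * f (Real.cos θ))
      volume a b := fun a b => by
    apply Continuous.intervalIntegrable
    exact (by fun_prop : Continuous fun θ : ℝ => cexp (-(I * j * θ))).mul hfc
  -- split at `π` and fold the second half
  rw [← intervalIntegral.integral_add_adjacent_intervals (hi 0 π) (hi π (2 * π))]
  have hfold : (∫ θ in π..2 * π, cexp (-(I * j * θ)) * f (Real.cos θ)) =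
      ∫ θ in (0 : ℝ)..π, cexp (I * j * θ) * f (Real.cos θ) := by
    have h := intervalIntegral.integral_comp_sub_left
      (fun θ : ℝ => cexp (-(I * j * θ)) * f (Real.cos θ)) (2 * π) (a := 0) (b := π)
    rw [show 2 * π - π = π by ring, sub_zero] at h
    rw [← h]
    refine intervalIntegral.integral_congr fun θ _ => ?_
    have hc : Real.cos (2 * π - θ) = Real.cos θ := by
      rw [Real.cos_sub, Real.cos_two_pi, Real.sin_two_pi]; ring
    simp only [hc]
    congr 1
    push_cast
    rw [show -(I * j * (2 * π - θ)) = I * j * θ + ((-(j : ℤ) : ℤ) : ℂ) * (2 * π * I) by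
      push_cast; ring, Complex.exp_add, Complex.exp_eq_one_iff.mpr ⟨-(j : ℤ), rfl⟩, mul_one]
  rw [hfold, ← intervalIntegral.integral_add (hi 0 π) (by
    apply Continuous.intervalIntegrable
    exact (by fun_prop : Continuous fun θ : ℝ => cexp (I * j * θ)).mul hfc)]
  simp only [chebCoeff]
  rw [← mul_assoc, show (π : ℂ) * (2 / π) = 2 by field_simp, ← intervalIntegral.integral_const_mul]
  refine intervalIntegral.integral_congr fun θ _ => ?_
  have h2cos : (2 : ℂ) * (Real.cos (j * θ) : ℂ) = cexp (-(I * j * θ)) + cexp (I * j * θ) := by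
    push_cast
    rw [Complex.two_cos, add_comm]
    congr 1 <;> congr 1 <;> ring
  linear_combination (f (Real.cos θ)) * h2cos

/-- **Chebyshev coefficients of analytic functions** (Trefethen 2008, Thm. 4.1 / (4.7) context:
Bernstein 1912): if `f` is analytic in the open Bernstein ellipse `E_ρ`, `ρ > 1`, with `‖f z‖ ≤ M`
there, then `|a_j(f)| ≤ 2 M ρ^{-j}` for all `j ≥ 0`. [cite: Trefethen2008, Thm. 4.2 (4.7)] -/
theorem norm_chebCoeff_le_of_differentiableOn_bernsteinEllipse {f : ℂ → ℂ} {ρ M : ℝ} (hρ : 1 < ρ)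
    (hf : DifferentiableOn ℂ f (bernsteinEllipse ρ)) (hM : ∀ z ∈ bernsteinEllipse ρ, ‖f z‖ ≤ M)
    (j : ℕ) : ‖chebCoeff (fun x : ℝ => f x) j‖ ≤ 2 * M / ρ ^ j := by
  have hρ0 : 0 < ρ := one_pos.trans hρ
  have hM0 : 0 ≤ M :=
    (norm_nonneg _).trans (hM _ (ofReal_mem_bernsteinEllipse hρ (t := 0) (by norm_num)))
  -- it suffices to prove the bound for every `r ∈ (1, ρ)`
  suffices key : ∀ r : ℝ, 1 < r → r < ρ → ‖chebCoeff (fun x : ℝ => f x) j‖ ≤ 2 * M / r ^ j by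
    have hcont : ContinuousAt (fun r : ℝ => 2 * M / r ^ j) ρ :=
      ContinuousAt.div continuousAt_const (by fun_prop) (pow_ne_zero _ hρ0.ne')
    refine ge_of_tendsto (hcont.tendsto.mono_left (nhdsWithin_le_nhds (s := Iio ρ))) ?_
    filter_upwards [Ioo_mem_nhdsLT hρ] with r hr using key r hr.1 hr.2
  intro r hr1 hrρ
  have hr0 : 0 < r := one_pos.trans hr1
  set a : ℝ := Real.log ρ with ha
  have ha0 : 0 < a := Real.log_pos hρ
  set a' : ℝ := Real.log r with ha'
  have ha'0 : 0 < a' := Real.log_pos hr1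
  have ha'a : a' < a := Real.log_lt_log hr0 hrρ
  -- `g = f ∘ cos` is `2π`-periodic, analytic and bounded in `|Im θ| < a`
  set g : ℂ → ℂ := fun z => f (Complex.cos z) with hg
  have hmem : ∀ z : ℂ, |z.im| < a → Complex.cos z ∈ bernsteinEllipse ρ := fun z hz =>
    (cos_mem_bernsteinEllipse_iff hρ z).mpr hz
  have hgd : DifferentiableOn ℂ g {z : ℂ | |z.im| < a} := fun z hz =>
    ((hf.differentiableAt ((isOpen_bernsteinEllipse ρ).mem_nhds (hmem z hz))).comp z
      (Complex.differentiable_cos z)).differentiableWithinAt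
  have hgper : ∀ z : ℂ, g (z + ((2 * π : ℝ) : ℂ)) = g z := by
    intro z
    simp only [hg]
    push_cast
    rw [Complex.cos_add_two_pi]
  have hgM : ∀ z : ℂ, |z.im| < a → ‖g z‖ ≤ M := fun z hz => hM _ (hmem z hz)
  -- `f` is continuous on `[-1, 1] ⊆ E_ρ`
  have hfc : ContinuousOn (fun x : ℝ => f x) (Icc (-1 : ℝ) 1) := by
    refine ContinuousOn.comp (t := bernsteinEllipse ρ) hf.continuousOn
      continuous_ofReal.continuousOn fun x hx => ofReal_mem_bernsteinEllipse hρ hx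
  -- the contour-shift bound for the `j`-th Fourier integral of `g`
  have h2π : (0 : ℝ) < 2 * π := Real.two_pi_pos
  have hF := norm_integral_exp_mul_le h2π hgd hgper hgM (j : ℤ) ha'0.le ha'a
  have hgcos : ∀ θ : ℝ, g θ = f (Real.cos θ) := by
    intro θ
    simp only [hg, Complex.ofReal_cos]
  simp_rw [hgcos] at hF
  rw [← pi_mul_chebCoeff_eq _ hfc j, norm_mul, Complex.norm_real,
    Real.norm_of_nonneg Real.pi_pos.le] at hF
  -- `e^{-2π a' j/(2π)} = r^{-j}`
  have hexp : Real.exp (-(2 * π * a' * |((j : ℤ) : ℝ)| / (2 * π))) = (r ^ j)⁻¹ := by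
    rw [show |((j : ℤ) : ℝ)| = j by push_cast; exact abs_of_nonneg (Nat.cast_nonneg j),
      show -(2 * π * a' * j / (2 * π)) = -(j * a') by field_simp, Real.exp_neg,
      Real.exp_nat_mul, ha', Real.exp_log hr0]
  rw [hexp] at hF
  rw [le_div_iff₀ (pow_pos hr0 j)]
  have hπ := Real.pi_pos
  have : π * ‖chebCoeff (fun x : ℝ => f x) j‖ * r ^ j ≤ 2 * π * M := by
    have h := mul_le_mul_of_nonneg_right hF (pow_pos hr0 j).le
    rwa [mul_assoc (2 * π * M), inv_mul_cancel₀ (pow_ne_zero _ hr0.ne'), mul_one] at h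
  nlinarith

/-! ### Theorem 4.5 (4.14) with the constant `64/15` (`n ≥ 2` nodes) -/

/-- **Trefethen 2008, Thm. 4.5 (4.14), with the paper's constant `64/15`** for the `n`-point
Gauss–Legendre rule with `n ≥ 2` (re-indexed: Trefethen's `n + 1` nodes, exponent `2n + 1` there
`= 2n - 1` here): if `f` is analytic in the open Bernstein ellipse `E_ρ` (`ρ > 1`) with
`‖f z‖ ≤ M` there, then `‖∫_{-1}^{1} f - Σ_x w_x f(x)‖ ≤ 64 M / (15 (ρ - 1) ρ^{2n-1})`.
(For `n ≥ 1` with the constant `8`: `norm_integral_sub_gaussLegendre_le`.)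
[cite: Trefethen2008, Thm. 4.5 (4.14)] -/
theorem norm_integral_sub_gaussLegendre_le_of_two_le {f : ℂ → ℂ} {ρ M : ℝ} (hρ : 1 < ρ)
    (hf : DifferentiableOn ℂ f (bernsteinEllipse ρ)) (hM : ∀ z ∈ bernsteinEllipse ρ, ‖f z‖ ≤ M)
    {n : ℕ} (hn : 2 ≤ n) :
    ‖(∫ t in (-1 : ℝ)..1, f t) -
        ∑ x ∈ gaussLegendreNodes n, (gaussLegendreWeight n x : ℂ) * f x‖ ≤
      64 * M / (15 * ((ρ - 1) * ρ ^ (2 * n - 1))) := by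
  have hρ0 : 0 < ρ := one_pos.trans hρ
  have hM0 : 0 ≤ M :=
    (norm_nonneg _).trans (hM _ (ofReal_mem_bernsteinEllipse hρ (t := 0) (by norm_num)))
  have hfc : ContinuousOn (fun x : ℝ => f x) (Icc (-1 : ℝ) 1) := by
    refine ContinuousOn.comp (t := bernsteinEllipse ρ) hf.continuousOn
      continuous_ofReal.continuousOn fun x hx => ofReal_mem_bernsteinEllipse hρ hx
  set q : ℝ := ρ⁻¹ with hq
  have hq0 : 0 < q := inv_pos.mpr hρ0
  have hq1 : q < 1 := inv_lt_one_of_one_lt₀ hρ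
  set b : ℕ → ℝ := fun j => 2 * M * q ^ j with hb
  have hble : ∀ j, ‖chebCoeff (fun x : ℝ => f x) j‖ ≤ b j := by
    intro j
    have h := norm_chebCoeff_le_of_differentiableOn_bernsteinEllipse hρ hf hM j
    simp only [hb, hq, inv_pow]
    rwa [← div_eq_mul_inv]
  have hbs : Summable b := (summable_geometric_of_lt_one hq0.le hq1).mul_left (2 * M)
  have key := norm_integral_sub_gaussLegendre_le_of_chebCoeff_le hfc hble hbs hn
  have htail : ∑' i : ℕ, b (i + 2 * n) = 2 * M * q ^ (2 * n) / (1 - q) := by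
    simp only [hb]
    have h1 : ∀ i : ℕ, 2 * M * q ^ (i + 2 * n) = 2 * M * q ^ (2 * n) * q ^ i := by
      intro i; rw [pow_add]; ring
    simp_rw [h1]
    rw [tsum_mul_left, tsum_geometric_of_lt_one hq0.le hq1, div_eq_mul_inv]
  rw [htail] at key
  refine key.trans (le_of_eq ?_)
  -- `32/15 · 2M q^{2n}/(1-q) = 64 M / (15 (ρ-1) ρ^{2n-1})`
  obtain ⟨N, hN⟩ : ∃ N : ℕ, 2 * n = N + 1 := ⟨2 * n - 1, by omega⟩
  rw [show 2 * n - 1 = N by omega, hN, hq]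
  have hρne : ρ ≠ 0 := hρ0.ne'
  have hρ1 : ρ - 1 ≠ 0 := sub_ne_zero.mpr hρ.ne'
  have hρN : ρ ^ N ≠ 0 := pow_ne_zero _ hρ0.ne'
  rw [show (ρ⁻¹) ^ (N + 1) = (ρ ^ N * ρ)⁻¹ by rw [inv_pow, pow_succ],
    show (1 : ℝ) - ρ⁻¹ = (ρ - 1) * ρ⁻¹ by field_simp]
  field_simp
  ring

/-- **Trefethen 2008, Thm. 4.5 (4.14) with the constant `64/15`, on `[a, b]`** (`n ≥ 2` nodes;
transport by `x ↦ (b-a)/2·x + (a+b)/2`): if `f` is analytic in the open ellipse with foci `a`, `b`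
and semi-axis sum `ρ (b-a)/2` (`ρ > 1`), with `‖f z‖ ≤ M` there, then
`‖∫_a^b f - Σ_x (b-a)/2 · w_x f((b-a)/2·x + (a+b)/2)‖ ≤ (b-a)/2 · 64 M / (15 (ρ - 1) ρ^{2n-1})`.
[cite: Trefethen2008, Thm. 4.5 (4.14)] -/
theorem norm_integral_sub_gaussLegendre_le_interval_of_two_le {f : ℂ → ℂ} {ρ M a b : ℝ}
    (hρ : 1 < ρ) (hab : a < b)
    (hf : DifferentiableOn ℂ f {z : ℂ | ‖z - a‖ + ‖z - b‖ < (ρ + ρ⁻¹) * ((b - a) / 2)})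
    (hM : ∀ z : ℂ, ‖z - a‖ + ‖z - b‖ < (ρ + ρ⁻¹) * ((b - a) / 2) → ‖f z‖ ≤ M)
    {n : ℕ} (hn : 2 ≤ n) :
    ‖(∫ t in a..b, f t) - ∑ x ∈ gaussLegendreNodes n,
        ((b - a) / 2 * gaussLegendreWeight n x : ℂ) * f ((b - a) / 2 * x + (a + b) / 2)‖ ≤
      (b - a) / 2 * (64 * M / (15 * ((ρ - 1) * ρ ^ (2 * n - 1)))) := by
  have hL0 : 0 < (b - a) / 2 := by linarith
  have hLc : (((b - a) / 2 : ℝ) : ℂ) ≠ 0 := by exact_mod_cast hL0.ne'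
  set g : ℂ → ℂ := fun z => f ((((b - a) / 2 : ℝ) : ℂ) * z + (((a + b) / 2 : ℝ) : ℂ)) with hg
  have hmaps : ∀ z : ℂ, z ∈ bernsteinEllipse ρ →
      ‖(((b - a) / 2 : ℝ) : ℂ) * z + (((a + b) / 2 : ℝ) : ℂ) - a‖ +
        ‖(((b - a) / 2 : ℝ) : ℂ) * z + (((a + b) / 2 : ℝ) : ℂ) - b‖ <
          (ρ + ρ⁻¹) * ((b - a) / 2) := by
    intro z hz
    have hz' : ‖z - 1‖ + ‖z + 1‖ < ρ + ρ⁻¹ := hz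
    have e1 : (((b - a) / 2 : ℝ) : ℂ) * z + (((a + b) / 2 : ℝ) : ℂ) - a =
        (((b - a) / 2 : ℝ) : ℂ) * (z + 1) := by
      push_cast
      ring
    have e2 : (((b - a) / 2 : ℝ) : ℂ) * z + (((a + b) / 2 : ℝ) : ℂ) - b =
        (((b - a) / 2 : ℝ) : ℂ) * (z - 1) := by
      push_cast
      ring
    rw [e1, e2, norm_mul, norm_mul, Complex.norm_real, Real.norm_of_nonneg hL0.le]
    nlinarith
  have hgd : DifferentiableOn ℂ g (bernsteinEllipse ρ) :=
    hf.comp (by fun_prop) fun z hz => hmaps z hz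
  have hgM : ∀ z ∈ bernsteinEllipse ρ, ‖g z‖ ≤ M := fun z hz => hM _ (hmaps z hz)
  have key := norm_integral_sub_gaussLegendre_le_of_two_le hρ hgd hgM hn
  -- the affine change of variables in the integral and in the sum
  have hint : (∫ t in a..b, f t) = (((b - a) / 2 : ℝ) : ℂ) * ∫ t in (-1 : ℝ)..1, g t := by
    have h := intervalIntegral.integral_comp_mul_add (fun t : ℝ => f t) hL0.ne' ((a + b) / 2)
      (a := -1) (b := 1)
    beta_reduce at h
    rw [show (b - a) / 2 * (-1 : ℝ) + (a + b) / 2 = a by ring,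
      show (b - a) / 2 * (1 : ℝ) + (a + b) / 2 = b by ring] at h
    have hg' : (fun t : ℝ => g t) = fun t : ℝ => f (((b - a) / 2 * t + (a + b) / 2 : ℝ) : ℂ) := by
      funext t
      simp only [hg]
      push_cast
      ring_nf
    rw [hg', h, Complex.real_smul, Complex.ofReal_inv, mul_inv_cancel_left₀ hLc]
  have hsum : ∑ x ∈ gaussLegendreNodes n,
      ((b - a) / 2 * gaussLegendreWeight n x : ℂ) * f ((b - a) / 2 * x + (a + b) / 2) =
        (((b - a) / 2 : ℝ) : ℂ) *
          ∑ x ∈ gaussLegendreNodes n, (gaussLegendreWeight n x : ℂ) * g x := by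
    rw [Finset.mul_sum]
    refine Finset.sum_congr rfl fun x _ => ?_
    simp only [hg]
    push_cast
    ring_nf
  rw [hint, hsum, ← mul_sub, norm_mul, Complex.norm_real, Real.norm_of_nonneg hL0.le]
  exact mul_le_mul_of_nonneg_left key hL0.le

end Literature.Analysis.Quadrature
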